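import Summits.HubbardSuperconductivity.HubbardSuperconductivity.Theorems.SeamGluingLocality.Negative.SquareShellCounting

/-!
# Shell counting on the free tubes (2/2): level multiplicities `≤ 2L`, room below half filling,
# closed shells near every target filling

Negative-side support for crux `SeamGluingLocality` (stmt-HubbardSuperconductivity-18509), consumed by
`SeamGluingLocality/Negative/ZeroCouplingDegeneracy.lean` (the `U = 0` twin of the crux is false).
Counting about the free band `ε_{L,M}(a,b) = -2cos(2πa/L) - 2cos(2πb/M)` (`tubeBand`), sorry-free:

* `card_filter_tubeBand_eq_le` — every level of `ε_{L,M}` holds at most `2L` momenta (a cosine takes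
  each value at most twice on `ℤ/M`, `card_filter_cos_eq_le_two`);
* `le_card_filter_tubeBand_neg` — for even `L, M`: `LM ≤ 2·#{ε_{L,M} < 0} + 2L` (the shift by
  `(L/2, M/2)` negates the band, `tubeBand_add_half` of part 1);
* `exists_closedShell_le` — generic: if every level of `ε : ι → ℝ` has multiplicity `≤ m`, then above
  every target `0 < t ≤ #{ε ≤ v₀}` there is a CLOSED-shell count `t ≤ #{ε ≤ μ} < t + m` with `μ ≤ v₀`
  (the least band value `μ` with `t ≤ #{ε ≤ μ}`; compare `exists_openShell_of_card_ne`).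

Folklore (free-electron shell structure). No definitions, no named facts.
-/

noncomputable section

namespace Summit.HubbardSuperconductivity.HubbardSuperconductivity.Theorems.SeamGluingLocality.Negative

set_option linter.dupNamespace false -- summit = problem name (single-conjunct summit), D-0017

open scoped BigOperators Classical
open Finset Summit.HubbardSuperconductivity.HubbardSuperconductivity.Theorems.WidthHaldane
open Summit.HubbardSuperconductivity.HubbardSuperconductivity.Theorems.PerWidthThermodynamics.Negative

/-! ### Level multiplicities of the free band are at most `2L` -/

section Multiplicity

variable {L M : ℕ} [NeZero L] [NeZero M]

/-- A cosine value is taken at most twice by `b ↦ cos(2πb/M)` on `ℤ/M` (once on each closed half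
period, by injectivity of `cos` on `[0, π]`). [folklore] -/
theorem card_filter_cos_eq_le_two (c : ℝ) :
    (univ.filter fun b : ZMod M => Real.cos (2 * Real.pi * (b.val : ℝ) / M) = c).card ≤ 2 := by
  set T := univ.filter fun b : ZMod M => Real.cos (2 * Real.pi * (b.val : ℝ) / M) = c with hT
  have hM0 : (0 : ℝ) < M := by exact_mod_cast NeZero.pos M
  have hθ : ∀ b : ZMod M, 2 * Real.pi * (b.val : ℝ) / M = (b.val : ℝ) * (2 * Real.pi / M) := fun b => by ring
  have hc0 : 0 < 2 * Real.pi / M := by positivity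
  -- angles of the lower half lie in `[0, π]`, of the upper half in `(π, 2π)`
  have hlow : ∀ b : ZMod M, 2 * b.val ≤ M → 2 * Real.pi * (b.val : ℝ) / M ∈ Set.Icc 0 Real.pi := fun b hb => by
    have hbR : 2 * (b.val : ℝ) ≤ M := by exact_mod_cast hb
    refine ⟨by positivity, ?_⟩
    rw [div_le_iff₀ hM0]; nlinarith [Real.pi_pos]
  have hup : ∀ b : ZMod M, ¬ 2 * b.val ≤ M →
      2 * Real.pi - 2 * Real.pi * (b.val : ℝ) / M ∈ Set.Icc 0 Real.pi := fun b hb => by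
    have hbR : (M : ℝ) < 2 * (b.val : ℝ) := by exact_mod_cast (not_le.1 hb)
    have hbM : (b.val : ℝ) < M := by exact_mod_cast ZMod.val_lt b
    refine ⟨?_, ?_⟩
    · rw [sub_nonneg, div_le_iff₀ hM0]; nlinarith [Real.pi_pos]
    · have : Real.pi < 2 * Real.pi * (b.val : ℝ) / M := by
        rw [lt_div_iff₀ hM0]; nlinarith [Real.pi_pos]
      linarith
  have hinj : ∀ b b' : ZMod M, 2 * Real.pi * (b.val : ℝ) / M = 2 * Real.pi * (b'.val : ℝ) / M → b = b' := by
    intro b b' h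
    rw [hθ, hθ] at h
    have hv : (b.val : ℝ) = b'.val := (mul_left_injective₀ hc0.ne') h
    exact ZMod.val_injective M (by exact_mod_cast hv)
  have h1 : (T.filter fun b => 2 * b.val ≤ M).card ≤ 1 := by
    refine Finset.card_le_one.2 fun b hb b' hb' => ?_
    rw [mem_filter, hT, mem_filter] at hb hb'
    have hcos : Real.cos (2 * Real.pi * (b.val : ℝ) / M) = Real.cos (2 * Real.pi * (b'.val : ℝ) / M) := by
      rw [hb.1.2, hb'.1.2]
    exact hinj b b' (Real.injOn_cos (hlow b hb.2) (hlow b' hb'.2) hcos)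
  have h2 : (T.filter fun b => ¬ 2 * b.val ≤ M).card ≤ 1 := by
    refine Finset.card_le_one.2 fun b hb b' hb' => ?_
    rw [mem_filter, hT, mem_filter] at hb hb'
    have hcos : Real.cos (2 * Real.pi - 2 * Real.pi * (b.val : ℝ) / M) =
        Real.cos (2 * Real.pi - 2 * Real.pi * (b'.val : ℝ) / M) := by
      rw [Real.cos_two_pi_sub, Real.cos_two_pi_sub, hb.1.2, hb'.1.2]
    have := Real.injOn_cos (hup b hb.2) (hup b' hb'.2) hcos
    exact hinj b b' (by linarith)
  have hsplit := card_filter_add_card_filter_not (s := T) (fun b => 2 * b.val ≤ M)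
  omega

/-- **Every level of the free band holds at most `2L` momenta**: for each first coordinate `a` the
second coordinate is determined up to sign by `cos(2πb/M) = -(ε + 2cos(2πa/L))/2`. [folklore] -/
theorem card_filter_tubeBand_eq_le (v : ℝ) :
    (univ.filter fun k : ZMod L × ZMod M => tubeBand L M k = v).card ≤ 2 * L := by
  set T := univ.filter fun k : ZMod L × ZMod M => tubeBand L M k = v with hT
  have hfib : ∀ a ∈ T.image Prod.fst, (T.filter fun k => k.1 = a).card ≤ 2 := by
    intro a _
    set c : ℝ := (-2 * Real.cos (2 * Real.pi * (a.val : ℝ) / L) - v) / 2 with hc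
    calc (T.filter fun k => k.1 = a).card
        ≤ (({a} : Finset (ZMod L)) ×ˢ
            (univ.filter fun b : ZMod M => Real.cos (2 * Real.pi * (b.val : ℝ) / M) = c)).card := by
          refine Finset.card_le_card fun k hk => ?_
          rw [mem_filter, hT, mem_filter] at hk
          rw [Finset.mem_product, mem_singleton, mem_filter]
          obtain ⟨⟨-, hv⟩, hka⟩ := hk
          refine ⟨hka, mem_univ _, ?_⟩
          rw [tubeBand, hka] at hv
          rw [hc]
          linarith
      _ = (univ.filter fun b : ZMod M => Real.cos (2 * Real.pi * (b.val : ℝ) / M) = c).card := by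
          rw [Finset.card_product, card_singleton, one_mul]
      _ ≤ 2 := card_filter_cos_eq_le_two c
  calc T.card ≤ 2 * (T.image Prod.fst).card := Finset.card_le_mul_card_image _ 2 hfib
    _ ≤ 2 * L := by
        have : (T.image Prod.fst).card ≤ L := by
          calc (T.image Prod.fst).card ≤ (univ : Finset (ZMod L)).card := card_le_card (subset_univ _)
            _ = L := by rw [card_univ, ZMod.card]
        omega

/-- **Below half filling there is room**: for even `L, M`, `LM ≤ 2·#{ε_{L,M} < 0} + 2L` — the shift by
`(L/2, M/2)` exchanges `{ε < 0}` and `{ε > 0}`, and the zero level holds at most `2L` momenta.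
[folklore] -/
theorem le_card_filter_tubeBand_neg (hL : Even L) (hM : Even M) :
    L * M ≤ 2 * (univ.filter fun k : ZMod L × ZMod M => tubeBand L M k < 0).card + 2 * L := by
  have hnegpos : (univ.filter fun k : ZMod L × ZMod M => tubeBand L M k < 0).card =
      (univ.filter fun k : ZMod L × ZMod M => 0 < tubeBand L M k).card := by
    refine Finset.card_equiv (Equiv.addRight ((((L / 2 : ℕ) : ZMod L), ((M / 2 : ℕ) : ZMod M)))) fun k => ?_
    simp only [mem_filter, mem_univ, true_and, Equiv.coe_addRight, tubeBand_add_half hL hM]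
    constructor
    · intro h; linarith
    · intro h; linarith
  have hzero := card_filter_tubeBand_eq_le (L := L) (M := M) 0
  -- `univ = {ε < 0} ⊔ {ε = 0} ⊔ {0 < ε}`
  have h1 := card_filter_add_card_filter_not (s := (univ : Finset (ZMod L × ZMod M))) (fun k => tubeBand L M k < 0)
  have h2 := card_filter_add_card_filter_not
    (s := (univ : Finset (ZMod L × ZMod M)).filter fun k => ¬ tubeBand L M k < 0) (fun k => tubeBand L M k = 0)
  have he : ((univ : Finset (ZMod L × ZMod M)).filter fun k => ¬ tubeBand L M k < 0).filter
      (fun k => tubeBand L M k = 0) = univ.filter fun k : ZMod L × ZMod M => tubeBand L M k = 0 := by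
    ext k
    simp only [mem_filter, mem_univ, true_and]
    constructor
    · exact fun h => h.2
    · intro h; exact ⟨by rw [h]; exact lt_irrefl 0, h⟩
  have hp : ((univ : Finset (ZMod L × ZMod M)).filter fun k => ¬ tubeBand L M k < 0).filter
      (fun k => ¬ tubeBand L M k = 0) = univ.filter fun k : ZMod L × ZMod M => 0 < tubeBand L M k := by
    ext k
    simp only [mem_filter, mem_univ, true_and, not_lt]
    constructor
    · rintro ⟨h, h'⟩; exact lt_of_le_of_ne h (Ne.symm h')
    · intro h; exact ⟨h.le, h.ne'⟩
  rw [he, hp, ← hnegpos] at h2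
  rw [card_univ, Fintype.card_prod, ZMod.card, ZMod.card] at h1
  omega

end Multiplicity

/-! ### Closed shells near every target filling -/

section ClosedShell

/-- **A closed shell within one multiplicity of every target.** If every level of `ε : ι → ℝ` holds at
most `m` indices and `0 < t ≤ #{ε ≤ v₀}`, then some CLOSED-shell count lands in `[t, t + m)`:
`t ≤ #{ε ≤ μ} < t + m` for a level `μ ≤ v₀` (the least band value `μ` with `t ≤ #{ε ≤ μ}` has
`#{ε < μ} < t`). [folklore] -/
theorem exists_closedShell_le {ι : Type*} [Fintype ι] (ε : ι → ℝ) {m t : ℕ}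
    (hmult : ∀ v : ℝ, (univ.filter fun k : ι => ε k = v).card ≤ m) (ht0 : 0 < t) {v₀ : ℝ}
    (ht : t ≤ (univ.filter fun k : ι => ε k ≤ v₀).card) :
    ∃ μ : ℝ, μ ≤ v₀ ∧ t ≤ (univ.filter fun k : ι => ε k ≤ μ).card ∧
      (univ.filter fun k : ι => ε k ≤ μ).card < t + m := by
  have hne0 : (univ.filter fun k : ι => ε k ≤ v₀).Nonempty := card_pos.1 (ht0.trans_le ht)
  obtain ⟨k₁, hk₁⟩ := hne0
  -- admissible band values
  set V : Finset ℝ := (univ.image ε).filter fun v => t ≤ (univ.filter fun k : ι => ε k ≤ v).card with hV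
  -- the largest band value `≤ v₀` is admissible
  set A₀ := ((univ.filter fun k : ι => ε k ≤ v₀).image ε) with hA₀
  have hA₀ne : A₀.Nonempty := ⟨ε k₁, mem_image_of_mem ε hk₁⟩
  set v₁ := A₀.max' hA₀ne with hv₁
  have hv₁mem : v₁ ∈ A₀ := Finset.max'_mem _ _
  rw [hA₀, mem_image] at hv₁mem
  obtain ⟨k₀, hk₀, hk₀v⟩ := hv₁mem
  have hv₁le : v₁ ≤ v₀ := by rw [← hk₀v]; exact (mem_filter.1 hk₀).2
  have hC₁ : (univ.filter fun k : ι => ε k ≤ v₁) = univ.filter fun k : ι => ε k ≤ v₀ := by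
    ext k
    simp only [mem_filter, mem_univ, true_and]
    exact ⟨fun h => h.trans hv₁le, fun h => Finset.le_max' A₀ _ (mem_image_of_mem ε (mem_filter.2 ⟨mem_univ _, h⟩))⟩
  have hv₁V : v₁ ∈ V := by
    rw [hV, mem_filter]
    refine ⟨mem_image.2 ⟨k₀, mem_univ _, hk₀v⟩, ?_⟩
    rw [hC₁]; exact ht
  have hVne : V.Nonempty := ⟨v₁, hv₁V⟩
  set μ := V.min' hVne with hμ
  have hμV : μ ∈ V := Finset.min'_mem _ _
  have hμV' := hμV
  rw [hV, mem_filter] at hμV'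
  refine ⟨μ, (Finset.min'_le V v₁ hv₁V).trans hv₁le, hμV'.2, ?_⟩
  -- strictly below `μ` there are fewer than `t` indices
  have hlt : (univ.filter fun k : ι => ε k < μ).card < t := by
    by_contra h
    rw [not_lt] at h
    have hne : (univ.filter fun k : ι => ε k < μ).Nonempty := card_pos.1 (ht0.trans_le h)
    set B := (univ.filter fun k : ι => ε k < μ).image ε with hB
    have hBne : B.Nonempty := hne.image ε
    obtain ⟨k₂, hk₂, hk₂v⟩ := Finset.mem_image.1 (Finset.max'_mem B hBne)
    have hv'lt : B.max' hBne < μ := by rw [← hk₂v]; exact (mem_filter.1 hk₂).2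
    have hsub : (univ.filter fun k : ι => ε k < μ) ⊆ univ.filter fun k : ι => ε k ≤ B.max' hBne := by
      intro k hk
      rw [mem_filter] at hk ⊢
      exact ⟨hk.1, Finset.le_max' B _ (mem_image_of_mem ε (mem_filter.2 hk))⟩
    have hv'V : B.max' hBne ∈ V := by
      rw [hV, mem_filter]
      exact ⟨mem_image.2 ⟨k₂, mem_univ _, hk₂v⟩, h.trans (Finset.card_le_card hsub)⟩
    have := Finset.min'_le V _ hv'V
    rw [← hμ] at this
    linarith
  -- `#{ε ≤ μ} = #{ε < μ} + #{ε = μ}`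
  have hsplit := card_filter_add_card_filter_not (s := univ.filter fun k : ι => ε k ≤ μ) (fun k => ε k < μ)
  have he1 : ((univ.filter fun k : ι => ε k ≤ μ).filter fun k => ε k < μ) = univ.filter fun k : ι => ε k < μ := by
    ext k
    simp only [mem_filter, mem_univ, true_and]
    exact ⟨fun h => h.2, fun h => ⟨h.le, h⟩⟩
  have he2 : ((univ.filter fun k : ι => ε k ≤ μ).filter fun k => ¬ ε k < μ) = univ.filter fun k : ι => ε k = μ := by
    ext k
    simp only [mem_filter, mem_univ, true_and, not_lt]
    exact ⟨fun h => le_antisymm h.1 h.2, fun h => ⟨h.le, h.ge⟩⟩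
  rw [he1, he2] at hsplit
  have := hmult μ
  omega

end ClosedShell

end Summit.HubbardSuperconductivity.HubbardSuperconductivity.Theorems.SeamGluingLocality.Negative

end
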